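import Mathlib
import Summits.CriticalPhenomena.CardyFormulaZ2.Theorems.CardySelfRefinementDefs
import Summits.CriticalPhenomena.CardyFormulaZ2.Theorems.CardySelfRefinementGradientComparabilityStubMonotoneRepBlocks
import Literature.Probability.Percolation.SelfRefinementMeasure
import HarnessLib

/-!
# Crux `GradientComparability` (stmt-CriticalPhenomena-10269), line `monotone-product-coordinates`:
# stub `stub_monotoneRep` — the monotone product representation of `M_k(ρ,c)`

Route `CardySelfRefinement`, sub-problem `CriticalPhenomena/CardyFormulaZ2`; vocabulary
(`ax`, `tb`, `cfg`, `prm`, `M`, …) from `CardySelfRefinementDefs` (definitionally the route's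
`let`-chain; `M k ρ c` is the tree's `selfRefinementMeasure k ρ c` by `rfl`); sequel of
`…StubMonotoneRepBlocks` (the block criterion `monoRep_M_eq_map_of_blocks`).

## Mathematics

The route's law `M_k(ρ,c)` is the push-forward of the product coin measure
`prodBernoulli (prm k ρ c)` (own coin of every fine edge; per bundle a SHARED fair coin and a
SELECTOR of bias `ρ`) under the read-out `cfg k` ("axial edge open iff (selector ∧ shared) ∨
(¬ selector ∧ own)"), which is NOT monotone in the selector.  The stub asserts that, for
`ρ, c ∈ [0,1]`, the same law is the push-forward of ANOTHER product coin measure — own coins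
unchanged; per bundle a force-open coin `a` of bias `ρ/2` and a not-force-closed coin `d′` of bias
`(2-2ρ)/(2-ρ)` — under the coordinatewise MONOTONE read-out "axial edge open iff
`a ∨ (d′ ∧ own)`" (the local notations `mPrm[k, ρ, c]`, `mOpn[k, S, e]`, `mCfg[k]` below are the
bodies inlined in the registered signature).

Proof.  Apply the block criterion of part A with the monotone block parameters `mQ[k, ρ, c]`
(own block: own coin and a dummy; tuple block: `a`, `d′`) and the monotone block code `mC`
(own block `3`/`0`; tuple block `a ↦ 3`, `¬a ∧ d′ ↦ 1`, `¬a ∧ ¬d′ ↦ 0`): the code is consistent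
with the monotone read-out (`monoRep_fkgOpen_iff`: the tree's rule "tuple code `≥ 3`, or tuple
code `≥ 1` and own code `≥ 3`" is `a ∨ (d′ ∧ own)`), own blocks have literally the tree's block
law (`monoRep_law_zero`), and a tuple block has, after merging the free codes, the atoms
(closed, free, —, open) `= ((1-ρ/2)(1-d′), (1-ρ/2)·d′, 0, ρ/2) = (ρ/2, 1-ρ, 0, ρ/2)`
(`monoRep_law_one_collapse_atoms`, the cancellation `(1-ρ/2)·d′ = 1-ρ`), the same as the route's
(`monoRep_fkgBlockLaw_one_collapse_atoms`).  Uniform in `k` (including `k = 0, 1`) and `c ∈ ℝ`.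
-/

noncomputable section

namespace Summit.CriticalPhenomena.CardyFormulaZ2.Theorems.CardySelfRefinement

open scoped Topology ENNReal
open Filter Set MeasureTheory ProbabilityTheory
open Literature.Probability.LatticeModels Literature.Probability.Percolation
open Literature.Probability.Percolation.QuadCrossing
open Summit.CriticalPhenomena.CardyFormulaZ2.Theses.CardySelfRefinement

/-! ## The monotone product coordinates -/

/-- Coin biases in monotone coordinates (the body inlined in the registered signature): slot `0` =
own coin of the fine edge (fair if axial, `c` otherwise — unchanged), slot `1` = the FORCE-OPEN coin
`a` of a bundle (bias `ρ/2`), slot `2` = the NOT-FORCE-CLOSED coin `d′` (bias `(2−2ρ)/(2−ρ)`). -/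
local notation3 (prettyPrint := false) "mPrm[" k ", " ρ ", " c "]" => fun i : Site 2 × Fin 2 × Fin 3 =>
  if i.2.2 = 0 then (if ax k (i.1, i.2.1) then half else Set.projIcc (0 : ℝ) 1 zero_le_one c)
  else if i.2.2 = 1 then Set.projIcc (0 : ℝ) 1 zero_le_one (ρ / 2)
  else Set.projIcc (0 : ℝ) 1 zero_le_one ((2 - 2 * ρ) / (2 - ρ))

/-- Monotone read-out of the edge `e` from the coins `S` (body inlined in the registered signature):
an axial edge is open iff `a ∨ (d′ ∧ own)`, a non-axial edge iff its own coin is on. -/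
local notation3 (prettyPrint := false) "mOpn[" k ", " S ", " e "]" =>
  (if ax k e then ((tb k e, e.2, (1 : Fin 3)) ∈ S ∨ ((tb k e, e.2, (2 : Fin 3)) ∈ S ∧ (e.1, e.2, (0 : Fin 3)) ∈ S))
    else (e.1, e.2, (0 : Fin 3)) ∈ S)

/-- Coins `↦` bond configuration, monotone version (body inlined in the registered signature). -/
local notation3 (prettyPrint := false) "mCfg[" k "]" => fun S : Set (Site 2 × Fin 2 × Fin 3) =>
  ({e | ∃ (v : Site 2) (d : Fin 2), e = s(v, v + (if d = 0 then ![1, 0] else ![0, 1])) ∧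
      (if ax k (v, d) then ((tb k (v, d), d, (1 : Fin 3)) ∈ S ∨
          ((tb k (v, d), d, (2 : Fin 3)) ∈ S ∧ (v, d, (0 : Fin 3)) ∈ S))
        else (v, d, (0 : Fin 3)) ∈ S)} : BondConfig (Site 2))

/-- Block parameters in monotone coordinates (cf. the tree's `fkgParam`): slot `0` of the own block
`(b, 0)` is the own coin (slot `1` a dummy of bias `0`); the tuple block `(b, 1)` carries `a`
(bias `ρ/2`) in slot `0` and `d′` (bias `(2-2ρ)/(2-ρ)`) in slot `1`. -/
local notation3 (prettyPrint := false) "mQ[" k ", " ρ ", " c "]" => fun (o : FKGBlock) (l : Fin 2) =>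
  if o.2 = 0 then (if l = 0 then mPrm[k, ρ, c] (o.1.1, o.1.2, 0) else (0 : unitInterval))
  else (if l = 0 then Set.projIcc (0 : ℝ) 1 zero_le_one (ρ / 2)
    else Set.projIcc (0 : ℝ) 1 zero_le_one ((2 - 2 * ρ) / (2 - ρ)))

/-- Block code in monotone coordinates (cf. the tree's `fkgCode`), values in the chain `Fin 4`: an
own block is coded `3`/`0` by its own coin; a tuple block with force-open coin `a` (slot `0`) and
not-force-closed coin `d′` (slot `1`) is coded `3` if `a`, `1` if `¬a ∧ d′`, `0` if `¬a ∧ ¬d′`. -/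
local notation3 (prettyPrint := false) "mC" => fun (o : FKGBlock) (g : Fin 2 → Prop) =>
  if o.2 = 0 then @ite (Fin 4) (g 0) (Classical.propDecidable _) 3 0
  else @ite (Fin 4) (g 0) (Classical.propDecidable _) 3 (@ite (Fin 4) (g 1) (Classical.propDecidable _) 1 0)

/-! ## The monotone read-out -/

/-- The monotone read-out of a fixed edge is a measurable function of the coins. -/
theorem monoRep_measurable_opn (k : ℕ) (e : Site 2 × Fin 2) :
    Measurable fun S : Set (Site 2 × Fin 2 × Fin 3) => mOpn[k, S, e] := by
  by_cases h : ax k e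
  · simp only [if_pos h]
    exact (measurable_set_mem _).or ((measurable_set_mem _).and (measurable_set_mem _))
  · simp only [if_neg h]
    exact measurable_set_mem _

-- adapted from `refinementConfig_eq_edgeConfig` (Literature/Probability/Percolation/SelfRefinementMeasure.lean)
/-- The monotone configuration map is the edge relabelling of its set of open labels. -/
theorem monoRep_cfg_eq_edgeConfig (k : ℕ) (S : Set (Site 2 × Fin 2 × Fin 3)) :
    mCfg[k] S = edgeConfig {e | mOpn[k, S, e]} := by
  beta_reduce
  ext x
  rw [Set.mem_setOf_eq, edgeConfig_eq_image, Set.mem_image]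
  constructor
  · rintro ⟨v, d, rfl, h⟩
    refine ⟨(v, d), h, ?_⟩
    rw [dirVec_eq_single]
    rfl
  · rintro ⟨⟨v, d⟩, h, rfl⟩
    refine ⟨v, d, ?_, h⟩
    rw [dirVec_eq_single]
    rfl

/-- The monotone configuration map is measurable. -/
theorem monoRep_measurable_cfg (k : ℕ) : Measurable mCfg[k] := by
  have h : mCfg[k] = edgeConfig ∘ fun S => {e | mOpn[k, S, e]} :=
    funext (monoRep_cfg_eq_edgeConfig k)
  rw [h]
  exact measurable_edgeConfig.comp (measurable_set_iff.2 fun e => monoRep_measurable_opn k e)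

/-! ## Consistency of the monotone block code -/

/-- **Consistency of the monotone block code**: the tree's opening rule in block coordinates
(`FKGOpen`: axial edge open iff tuple code `≥ 3`, or tuple code `≥ 1` and own code `≥ 3`) read
off the monotone codes of an enlarged coin sample is the monotone read-out `a ∨ (d′ ∧ own)` of the
coins it carries. -/
theorem monoRep_fkgOpen_iff (k : ℕ) (ω : FKGBlock × Fin 2 → Prop) (e : Site 2 × Fin 2) :
    FKGOpen k (fun o => mC o fun l => ω (o, l)) e ↔ mOpn[k, {i | ω (coinSlot i)}, e] := by
  have htb : tb k e = tupleBase k e := rfl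
  by_cases hax : IsAxialEdge k e
  · simp only [FKGOpen, if_pos hax, Set.mem_setOf_eq, coinSlot_apply_two, coinSlot_apply_one,
      coinSlot_apply_zero, htb]
    by_cases h0 : ω (((tupleBase k e, e.2), 1), 0) <;> by_cases h1 : ω (((tupleBase k e, e.2), 1), 1) <;>
      by_cases h2 : ω (((e.1, e.2), 0), 0) <;> simp [h0, h1, h2]
  · simp only [FKGOpen, if_neg hax, Set.mem_setOf_eq, coinSlot_apply_zero]
    by_cases h2 : ω (((e.1, e.2), 0), 0) <;> simp [h2]

/-- Consistency at the level of configurations. -/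
theorem monoRep_fkgConfig_eq (k : ℕ) (ω : FKGBlock × Fin 2 → Prop) :
    fkgConfig k (fun o => mC o fun l => ω (o, l)) = mCfg[k] {i | ω (coinSlot i)} := by
  refine Eq.trans ?_ (monoRep_cfg_eq_edgeConfig k _).symm
  rw [fkgConfig]
  congr 1
  ext e
  exact monoRep_fkgOpen_iff k ω e

/-- The block parameters extend the monotone coin parameters along `coinSlot`. -/
theorem monoRep_param_coinSlot (k : ℕ) (ρ c : ℝ) :
    ∀ i : Site 2 × Fin 2 × Fin 3, mQ[k, ρ, c] (coinSlot i).1 (coinSlot i).2 = mPrm[k, ρ, c] i := by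
  rintro ⟨x, d, j⟩
  fin_cases j <;> simp

/-! ## The block laws in monotone coordinates -/

/-- Own blocks: the monotone block law IS the tree's block law. -/
theorem monoRep_law_zero (k : ℕ) (ρ c : ℝ) (b : Site 2 × Fin 2) :
    (Measure.infinitePi fun l : Fin 2 => (Ber(True, False, mQ[k, ρ, c] (b, 0) l) : Measure Prop)).map
        (mC (b, 0)) = fkgBlockLaw k ρ c (b, 0) := by
  have hC : mC (b, 0) = fkgCode (b, 0) := by
    funext g
    simp [fkgCode]
  have hQ : (fun l : Fin 2 => (Ber(True, False, mQ[k, ρ, c] (b, 0) l) : Measure Prop)) =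
      fun l => Ber(True, False, fkgParam k ρ c (b, 0) l) := by
    funext l
    fin_cases l <;> simp [fkgParam, refinementParam]
  rw [fkgBlockLaw]
  exact congr (congrArg Measure.map hC) (congrArg Measure.infinitePi hQ)

/-- **The atoms of the recoded law of a tuple block in monotone coordinates** (`ρ ∈ [0,1]`):
force-open coin `a` of bias `ρ/2`, not-force-closed coin `d′` of bias `(2-2ρ)/(2-ρ)`; forced
closed (`¬a ∧ ¬d′`, code `0`) has mass `(1-ρ/2)(1-d′) = ρ/2`, free (`¬a ∧ d′`, code `1`) mass
`(1-ρ/2)·d′ = 1-ρ`, code `2` no mass, forced open (`a`, code `3`) mass `ρ/2` — the same atoms as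
the route's (`monoRep_fkgBlockLaw_one_collapse_atoms`). -/
theorem monoRep_law_one_collapse_atoms (k : ℕ) {ρ : ℝ} (hρ : ρ ∈ Set.Icc (0 : ℝ) 1) (c : ℝ)
    (b : Site 2 × Fin 2) :
    (((Measure.infinitePi fun l : Fin 2 => (Ber(True, False, mQ[k, ρ, c] (b, 1) l) : Measure Prop)).map
        (mC (b, 1))).map (fun x : Fin 4 => if x = 2 then 1 else x)) {0} = ENNReal.ofReal (ρ / 2) ∧
    (((Measure.infinitePi fun l : Fin 2 => (Ber(True, False, mQ[k, ρ, c] (b, 1) l) : Measure Prop)).map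
        (mC (b, 1))).map (fun x : Fin 4 => if x = 2 then 1 else x)) {1} = ENNReal.ofReal (1 - ρ) ∧
    (((Measure.infinitePi fun l : Fin 2 => (Ber(True, False, mQ[k, ρ, c] (b, 1) l) : Measure Prop)).map
        (mC (b, 1))).map (fun x : Fin 4 => if x = 2 then 1 else x)) {2} = 0 ∧
    (((Measure.infinitePi fun l : Fin 2 => (Ber(True, False, mQ[k, ρ, c] (b, 1) l) : Measure Prop)).map
        (mC (b, 1))).map (fun x : Fin 4 => if x = 2 then 1 else x)) {3} = ENNReal.ofReal (ρ / 2) := by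
  have hcm : Measurable (fun x : Fin 4 => if x = 2 then (1 : Fin 4) else x) := measurable_of_countable _
  rw [Measure.map_map hcm (measurable_of_countable _)]
  have h2 : (2 - ρ) ≠ 0 := by
    intro h
    linarith [hρ.2]
  have hhalf : ρ / 2 ∈ Set.Icc (0 : ℝ) 1 := ⟨by linarith [hρ.1], by linarith [hρ.2]⟩
  have hd : (2 - 2 * ρ) / (2 - ρ) ∈ Set.Icc (0 : ℝ) 1 := by
    have hpos : 0 < 2 - ρ := by linarith [hρ.2]
    constructor
    · exact div_nonneg (by linarith [hρ.2]) hpos.le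
    · rw [div_le_one hpos]
      linarith [hρ.1]
  have h0v : ((mQ[k, ρ, c] (b, 1) 0 : unitInterval) : ℝ) = ρ / 2 := by
    simp [Set.projIcc_of_mem _ hhalf]
  have h1v : ((mQ[k, ρ, c] (b, 1) 1 : unitInterval) : ℝ) = (2 - 2 * ρ) / (2 - ρ) := by
    simp [Set.projIcc_of_mem _ hd]
  -- the key cancellation `(1 - ρ/2) · d′ = 1 - ρ` and its complement `(1 - ρ/2) (1 - d′) = ρ/2`
  have hkey : (1 - ρ / 2) * ((2 - 2 * ρ) / (2 - ρ)) = 1 - ρ := by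
    rw [← mul_div_assoc, div_eq_iff h2]
    ring
  have hkey' : (1 - ρ / 2) * (1 - (2 - 2 * ρ) / (2 - ρ)) = ρ / 2 := by
    rw [mul_sub, mul_one, hkey]
    ring
  refine ⟨?_, ?_, ?_, ?_⟩
  · -- forced closed: `¬ a ∧ ¬ d′`
    rw [monoRep_twoCoin_map_apply_singleton _ _ _ {False} {False} fun g => by
        by_cases h0 : g 0 <;> by_cases h1 : g 1 <;> simp [h0, h1]]
    rw [bernoulliMeasure_prop_apply_false, bernoulliMeasure_prop_apply_false, h0v, h1v,
      ← ENNReal.ofReal_mul (by linarith [hρ.2]), hkey']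
  · -- free: `¬ a ∧ d′`
    rw [monoRep_twoCoin_map_apply_singleton _ _ _ {False} {True} fun g => by
        by_cases h0 : g 0 <;> by_cases h1 : g 1 <;> simp [h0, h1]]
    rw [bernoulliMeasure_prop_apply_false, bernoulliMeasure_prop_apply_true, h0v, h1v,
      ← ENNReal.ofReal_mul (by linarith [hρ.2]), hkey]
  · -- the merged code `2`: no mass
    rw [monoRep_twoCoin_map_apply_singleton _ _ _ ∅ Set.univ fun g => by
        by_cases h0 : g 0 <;> by_cases h1 : g 1 <;> simp [h0, h1]]
    rw [measure_empty, zero_mul]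
  · -- forced open: `a`
    rw [monoRep_twoCoin_map_apply_singleton _ _ _ {True} Set.univ fun g => by
        by_cases h0 : g 0 <;> by_cases h1 : g 1 <;> simp [h0, h1]]
    rw [measure_univ, mul_one, bernoulliMeasure_prop_apply_true, h0v]

/-- **All blocks: the monotone block laws and the tree's block laws agree after merging the free
codes** (`ρ ∈ [0,1]`, any `c`, any `k`). -/
theorem monoRep_law_collapse (k : ℕ) {ρ : ℝ} (hρ : ρ ∈ Set.Icc (0 : ℝ) 1) (c : ℝ) :
    ∀ o : FKGBlock,
      ((Measure.infinitePi fun l : Fin 2 => (Ber(True, False, mQ[k, ρ, c] o l) : Measure Prop)).map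
          (mC o)).map (fun x : Fin 4 => if x = 2 then 1 else x) =
        (fkgBlockLaw k ρ c o).map (fun x : Fin 4 => if x = 2 then 1 else x) := by
  rintro ⟨b, j⟩
  fin_cases j
  · exact congrArg (Measure.map fun x : Fin 4 => if x = 2 then 1 else x) (monoRep_law_zero k ρ c b)
  · obtain ⟨m0, m1, m2, m3⟩ := monoRep_law_one_collapse_atoms k hρ c b
    obtain ⟨r0, r1, r2, r3⟩ := monoRep_fkgBlockLaw_one_collapse_atoms k hρ c b
    exact Measure.ext_of_singleton (monoRep_forall_fin4 (m0.trans r0.symm) (m1.trans r1.symm)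
      (m2.trans r2.symm) (m3.trans r3.symm))

/-! ## The representation -/

/-- **`M_k(ρ,c)` in monotone product coordinates**: for `ρ ∈ [0,1]` (any `c`, any `k`) the route's
law is the push-forward of the monotone coin product under the monotone read-out
(`monoRep_M_eq_map_of_blocks` with the monotone block code). -/
theorem monoRep_M_eq_map (k : ℕ) {ρ : ℝ} (hρ : ρ ∈ Set.Icc (0 : ℝ) 1) (c : ℝ) :
    M k ρ c = (prodBernoulli mPrm[k, ρ, c]).map mCfg[k] :=
  monoRep_M_eq_map_of_blocks k ρ c (monoRep_measurable_cfg k) mQ[k, ρ, c] mC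
    (monoRep_param_coinSlot k ρ c) (monoRep_fkgConfig_eq k) (monoRep_law_collapse k hρ c)

/-- **STUB `stub_monotoneRep`** of line `monotone-product-coordinates` (crux `GradientComparability`):
the MONOTONE PRODUCT REPRESENTATION.  For `ρ, c ∈ [0,1]` the route's law `M_k(ρ,c)` equals the
push-forward of the product coin measure with biases (own: `½` if axial, `c` otherwise; force-open
`a`: `ρ/2`; not-force-closed `d′`: `(2−2ρ)/(2−ρ)`) under the coordinatewise monotone read-out
"axial edge open iff `a ∨ (d′ ∧ own)`, non-axial edge open iff own" (`monoRep_M_eq_map`, bodies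
inlined). -/
theorem stub_monotoneRep :
    ∀ k : ℕ, ∀ ρ ∈ Set.Icc (0 : ℝ) 1, ∀ c ∈ Set.Icc (0 : ℝ) 1,
      M k ρ c =
        (prodBernoulli (fun i : Site 2 × Fin 2 × Fin 3 =>
            if i.2.2 = 0 then (if ax k (i.1, i.2.1) then half else Set.projIcc (0 : ℝ) 1 zero_le_one c)
            else if i.2.2 = 1 then Set.projIcc (0 : ℝ) 1 zero_le_one (ρ / 2)
            else Set.projIcc (0 : ℝ) 1 zero_le_one ((2 - 2 * ρ) / (2 - ρ)))).map
          (fun S : Set (Site 2 × Fin 2 × Fin 3) =>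
            ({e | ∃ (v : Site 2) (d : Fin 2), e = s(v, v + (if d = 0 then ![1, 0] else ![0, 1])) ∧
                (if ax k (v, d) then ((tb k (v, d), d, (1 : Fin 3)) ∈ S ∨
                    ((tb k (v, d), d, (2 : Fin 3)) ∈ S ∧ (v, d, (0 : Fin 3)) ∈ S))
                  else (v, d, (0 : Fin 3)) ∈ S)} : BondConfig (Site 2))) :=
  fun k _ hρ c _ => monoRep_M_eq_map k hρ c

end Summit.CriticalPhenomena.CardyFormulaZ2.Theorems.CardySelfRefinement

end
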